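import Mathlib

/-!
# `DissociatedFixedK` (stmt-ValiantsHypothesis-5907), line `annihilator-product-functional` —
registered stub `stub_cmpPatCount`: comparison patterns of a linear functional on a finite planar set

Blueprint step 4 (counting the box tops) of crux `…Theses.NewtonUnitEquations.DissociatedFixedK`
(route NewtonUnitEquations, rank 4) needs: as an ARBITRARY continuous linear functional `l` on `ℝ²`
varies, its comparison pattern on a fixed finite `P ⊂ ℝ²` (which of `l p < l q` hold) takes at most
`4 |P|² + 7` values — `ncard_range_cmpPat_le` / `stub_cmpPatCount`, by reduction to the one-parameter
sweeps `(1, s)`, `(-1, -s)`, `(0, ±1)`, `0` and counting the sign vectors of finitely many affine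
functions of one real variable between consecutive roots (`ncard_range_signVec_le`, `≤ 2|D| + 2`
patterns; pure root counting, no topology).  `stub_cmpPatCount` is the registered sub-goal of
`stub_topTupleCount` (file `…DissociatedFixedKTopTupleCount.lean`: the lex-top tuple factors through the
comparison pattern).  Ported verbatim from the standing disprover's checked PROVER KIT
(`Cruxes/DissociatedFixedK/Disproof.lean` v3 §E2–§E3).  [folklore]
-/

namespace Summit.ValiantsHypothesis.Theorems.DissociatedFixedK

open scoped BigOperators Classical
open Finset

noncomputable section

/-! ## §E2  Blueprint step 4 (counting): sign patterns along a one-parameter sweep -/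

section Sweep

/-- The sign vector of the affine functions `λ ↦ d.1 + λ·d.2`, `d ∈ D`, at the parameter `λ`. -/
noncomputable def signVec (D : Finset (ℝ × ℝ)) (t : ℝ) : ↥D → SignType :=
  fun d => SignType.sign (d.1.1 + t * d.1.2)

/-- The roots of the non-constant affine functions. -/
noncomputable def sweepRoots (D : Finset (ℝ × ℝ)) : Finset ℝ :=
  (D.filter (fun d => d.2 ≠ 0)).image (fun d => -d.1 / d.2)

/-- There are at most `|D|` roots. -/
theorem card_sweepRoots_le (D : Finset (ℝ × ℝ)) : (sweepRoots D).card ≤ D.card :=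
  Finset.card_image_le.trans (Finset.card_filter_le _ _)

/-- The combinatorial position of `λ` relative to the roots: (number of roots below, is a root). -/
noncomputable def sweepKey (D : Finset (ℝ × ℝ)) (t : ℝ) : ℕ × Bool :=
  (((sweepRoots D).filter (fun r => r < t)).card, decide (t ∈ sweepRoots D))

/-- The key lives in a finite box of size `(#roots + 1) · 2`. -/
theorem sweepKey_mem (D : Finset (ℝ × ℝ)) (t : ℝ) :
    sweepKey D t ∈ (Finset.range ((sweepRoots D).card + 1) ×ˢ (Finset.univ : Finset Bool)) := by
  simp only [sweepKey, Finset.mem_product, Finset.mem_range, Finset.mem_univ, and_true]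
  exact Nat.lt_succ_of_le (Finset.card_filter_le _ _)

/-- Core of the sweep: between (and off) the roots the sign vector is constant.  Version `t < t'`. -/
theorem signVec_eq_of_sweepKey_eq_of_lt (D : Finset (ℝ × ℝ)) {t t' : ℝ} (htt' : t < t')
    (hkey : sweepKey D t = sweepKey D t') : signVec D t = signVec D t' := by
  have hsub : (sweepRoots D).filter (fun r => r < t) ⊆ (sweepRoots D).filter (fun r => r < t') := by
    intro r hr
    simp only [Finset.mem_filter] at hr ⊢
    exact ⟨hr.1, hr.2.trans htt'⟩
  have hcard : ((sweepRoots D).filter (fun r => r < t)).card =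
      ((sweepRoots D).filter (fun r => r < t')).card := congrArg Prod.fst hkey
  -- no root in `[t, t')`
  have hnoroot : ∀ r ∈ sweepRoots D, ¬ (t ≤ r ∧ r < t') := by
    rintro r hr ⟨h1, h2⟩
    have hss : (sweepRoots D).filter (fun r => r < t) ⊂ (sweepRoots D).filter (fun r => r < t') := by
      refine Finset.ssubset_iff_of_subset hsub |>.mpr ⟨r, ?_, ?_⟩
      · simp [hr, h2]
      · simp [not_lt.mpr h1]
    exact absurd hcard (Finset.card_lt_card hss).ne
  have ht : t ∉ sweepRoots D := fun h => hnoroot t h ⟨le_rfl, htt'⟩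
  have ht' : t' ∉ sweepRoots D := by
    have := congrArg Prod.snd hkey
    simp only [sweepKey, decide_eq_decide] at this
    exact fun h => ht (this.mpr h)
  funext d
  simp only [signVec]
  by_cases hd2 : d.1.2 = 0
  · simp [hd2]
  · set r : ℝ := -d.1.1 / d.1.2 with hr
    have hrmem : r ∈ sweepRoots D :=
      Finset.mem_image.mpr ⟨d.1, Finset.mem_filter.mpr ⟨d.2, hd2⟩, rfl⟩
    have hfac : ∀ s : ℝ, d.1.1 + s * d.1.2 = d.1.2 * (s - r) := by
      intro s; rw [hr]; field_simp; ring
    rw [hfac t, hfac t', sign_mul, sign_mul]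
    congr 1
    have htr : t ≠ r := fun h => ht (h ▸ hrmem)
    have ht'r : t' ≠ r := fun h => ht' (h ▸ hrmem)
    rcases lt_or_gt_of_ne htr with h | h
    · -- t < r : then also t' < r (no root in [t, t'))
      have h' : t' < r := by
        rcases lt_or_gt_of_ne ht'r with h' | h'
        · exact h'
        · exact absurd ⟨h.le, h'⟩ (hnoroot r hrmem)
      rw [sign_neg (sub_neg.mpr h), sign_neg (sub_neg.mpr h')]
    · have h' : r < t' := h.trans htt'
      rw [sign_pos (sub_pos.mpr h), sign_pos (sub_pos.mpr h')]

/-- Equal keys give equal sign vectors (symmetric form of the previous lemma). -/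
theorem signVec_eq_of_sweepKey_eq (D : Finset (ℝ × ℝ)) {t t' : ℝ}
    (hkey : sweepKey D t = sweepKey D t') : signVec D t = signVec D t' := by
  rcases lt_trichotomy t t' with h | rfl | h
  · exact signVec_eq_of_sweepKey_eq_of_lt D h hkey
  · rfl
  · exact (signVec_eq_of_sweepKey_eq_of_lt D h hkey.symm).symm

/-- **Sweep count.** The sign vectors of `|D|` affine functions of one real parameter take at most
`2|D| + 2` values. [folklore] -/
theorem ncard_range_signVec_le (D : Finset (ℝ × ℝ)) :
    (Set.range (signVec D)).ncard ≤ 2 * D.card + 2 := by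
  classical
  -- choose a parameter for each realised sign vector and map it to its key
  have hchoose : ∀ s ∈ Set.range (signVec D), ∃ t, signVec D t = s := fun s hs => hs
  choose par hpar using hchoose
  set T : Finset (ℕ × Bool) :=
    Finset.range ((sweepRoots D).card + 1) ×ˢ (Finset.univ : Finset Bool) with hT
  have hmaps : ∀ s (hs : s ∈ Set.range (signVec D)), sweepKey D (par s hs) ∈ (T : Set (ℕ × Bool)) :=
    fun s hs => by exact_mod_cast sweepKey_mem D (par s hs)
  -- injectivity of s ↦ key (par s) on the range
  let φ : (↥D → SignType) → ℕ × Bool := fun s =>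
    if hs : s ∈ Set.range (signVec D) then sweepKey D (par s hs) else (0, false)
  have hφmaps : ∀ s ∈ Set.range (signVec D), φ s ∈ (T : Set (ℕ × Bool)) := by
    intro s hs; simp only [φ, dif_pos hs]; exact hmaps s hs
  have hφinj : Set.InjOn φ (Set.range (signVec D)) := by
    intro s hs s' hs' h
    simp only [φ, dif_pos hs, dif_pos hs'] at h
    rw [← hpar s hs, ← hpar s' hs']
    exact signVec_eq_of_sweepKey_eq D h
  have h1 : (Set.range (signVec D)).ncard ≤ (T : Set (ℕ × Bool)).ncard :=
    Set.ncard_le_ncard_of_injOn φ hφmaps hφinj (Finset.finite_toSet T)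
  rw [Set.ncard_coe_finset] at h1
  have h2 : T.card = ((sweepRoots D).card + 1) * 2 := by
    simp [hT, Finset.card_product]
  have h3 := card_sweepRoots_le D
  calc (Set.range (signVec D)).ncard ≤ T.card := h1
    _ = ((sweepRoots D).card + 1) * 2 := h2
    _ ≤ 2 * D.card + 2 := by omega

end Sweep

/-! ## §E3  Comparison patterns of linear functionals on a finite planar point set -/

section CmpPat

/-- The comparison pattern a continuous linear functional induces on a finite point set. -/
noncomputable def cmpPat (P : Finset (Fin 2 → ℝ)) (l : (Fin 2 → ℝ) →L[ℝ] ℝ) : ↥P × ↥P → Bool :=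
  fun pq => decide (l pq.1 < l pq.2)

/-- The difference vectors of `P`, as pairs of reals. -/
noncomputable def diffSet (P : Finset (Fin 2 → ℝ)) : Finset (ℝ × ℝ) :=
  (P ×ˢ P).image (fun pq => (pq.2 0 - pq.1 0, pq.2 1 - pq.1 1))

/-- There are at most `|P|²` difference vectors. -/
theorem card_diffSet_le (P : Finset (Fin 2 → ℝ)) : (diffSet P).card ≤ P.card * P.card :=
  Finset.card_image_le.trans (by rw [Finset.card_product])

/-- The difference of two points of `P` lies in `diffSet P`. -/
theorem diff_mem_diffSet (P : Finset (Fin 2 → ℝ)) (pq : ↥P × ↥P) :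
    ((pq.2 : Fin 2 → ℝ) 0 - (pq.1 : Fin 2 → ℝ) 0, (pq.2 : Fin 2 → ℝ) 1 - (pq.1 : Fin 2 → ℝ) 1)
      ∈ diffSet P :=
  Finset.mem_image.mpr ⟨((pq.1 : Fin 2 → ℝ), (pq.2 : Fin 2 → ℝ)),
    Finset.mem_product.mpr ⟨pq.1.2, pq.2.2⟩, rfl⟩

/-- A linear functional on `ℝ²` in coordinates. -/
theorem clm_apply_fin_two (l : (Fin 2 → ℝ) →L[ℝ] ℝ) (v : Fin 2 → ℝ) :
    l v = l (Pi.single 0 1) * v 0 + l (Pi.single 1 1) * v 1 := by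
  have hv : v = v 0 • (Pi.single 0 1 : Fin 2 → ℝ) + v 1 • (Pi.single 1 1 : Fin 2 → ℝ) := by
    funext i
    fin_cases i <;> simp
  conv_lhs => rw [hv]
  simp only [map_add, map_smul, smul_eq_mul]
  ring

/-- **Pattern count.** As `l` ranges over ALL continuous linear functionals on `ℝ²`, the comparison
pattern on a finite set `P` takes at most `4|P|² + 7` values (sweep `l = (±1, λ)`, `(0, ±1)`, `0`).
[folklore] -/
theorem ncard_range_cmpPat_le (P : Finset (Fin 2 → ℝ)) :
    (Set.range (cmpPat P)).ncard ≤ 4 * (P.card * P.card) + 7 := by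
  classical
  set D := diffSet P with hD
  -- decoders
  let dv : ↥P × ↥P → ↥D := fun pq => ⟨_, diff_mem_diffSet P pq⟩
  let Fp : (↥D → SignType) → (↥P × ↥P → Bool) := fun s pq => decide (s (dv pq) = 1)
  let Fm : (↥D → SignType) → (↥P × ↥P → Bool) := fun s pq => decide (s (dv pq) = -1)
  let G : SignType → (↥P × ↥P → Bool) := fun σ pq =>
    decide (σ * SignType.sign ((pq.2 : Fin 2 → ℝ) 1 - (pq.1 : Fin 2 → ℝ) 1) = 1)
  have hcover : Set.range (cmpPat P) ⊆
      (Fp '' Set.range (signVec D) ∪ Fm '' Set.range (signVec D)) ∪ G '' Set.univ := by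
    rintro _ ⟨l, rfl⟩
    set l₁ := l (Pi.single 0 1) with hl₁
    set l₂ := l (Pi.single 1 1) with hl₂
    have hdiff : ∀ pq : ↥P × ↥P, l pq.2 - l pq.1 =
        l₁ * ((pq.2 : Fin 2 → ℝ) 0 - (pq.1 : Fin 2 → ℝ) 0) +
          l₂ * ((pq.2 : Fin 2 → ℝ) 1 - (pq.1 : Fin 2 → ℝ) 1) := by
      intro pq
      rw [clm_apply_fin_two l (pq.2 : Fin 2 → ℝ), clm_apply_fin_two l (pq.1 : Fin 2 → ℝ)]
      ring
    rcases lt_trichotomy 0 l₁ with h1 | h1 | h1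
    · -- l₁ > 0
      left; left
      refine ⟨signVec D (l₂ / l₁), ⟨l₂ / l₁, rfl⟩, ?_⟩
      funext pq
      simp only [Fp, cmpPat, signVec, dv]
      have key : (0 : ℝ) < ((pq.2 : Fin 2 → ℝ) 0 - (pq.1 : Fin 2 → ℝ) 0) +
          l₂ / l₁ * ((pq.2 : Fin 2 → ℝ) 1 - (pq.1 : Fin 2 → ℝ) 1) ↔ l pq.1 < l pq.2 := by
        rw [← sub_pos (a := l pq.2), hdiff pq]
        constructor
        · intro h
          have := mul_pos h1 h
          calc (0 : ℝ) < l₁ * ((pq.2 : Fin 2 → ℝ) 0 - (pq.1 : Fin 2 → ℝ) 0 +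
              l₂ / l₁ * ((pq.2 : Fin 2 → ℝ) 1 - (pq.1 : Fin 2 → ℝ) 1)) := this
            _ = _ := by field_simp
        · intro h
          have := div_pos h h1
          calc (0 : ℝ) < (l₁ * ((pq.2 : Fin 2 → ℝ) 0 - (pq.1 : Fin 2 → ℝ) 0) +
              l₂ * ((pq.2 : Fin 2 → ℝ) 1 - (pq.1 : Fin 2 → ℝ) 1)) / l₁ := this
            _ = _ := by field_simp
      by_cases hc : l pq.1 < l pq.2
      · have hpos := key.mpr hc
        simp [hc, sign_pos hpos]
      · have hnpos : ¬ (0 : ℝ) < _ := fun h => hc (key.mp h)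
        rcases eq_or_lt_of_le (not_lt.mp hnpos) with h0 | hneg
        · simp [hc, h0]
        · simp [hc, sign_neg hneg]
    · -- l₁ = 0
      right
      refine ⟨SignType.sign l₂, Set.mem_univ _, ?_⟩
      funext pq
      simp only [G, cmpPat]
      have key : l pq.1 < l pq.2 ↔ 0 < l₂ * ((pq.2 : Fin 2 → ℝ) 1 - (pq.1 : Fin 2 → ℝ) 1) := by
        rw [← sub_pos (a := l pq.2), hdiff pq, ← h1]; simp
      rw [← sign_mul]
      by_cases hc : l pq.1 < l pq.2
      · simp [hc, sign_pos (key.mp hc)]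
      · have hnpos : ¬ (0 : ℝ) < _ := fun h => hc (key.mpr h)
        rcases eq_or_lt_of_le (not_lt.mp hnpos) with h0 | hneg
        · simp [hc, h0]
        · simp [hc, sign_neg hneg]
    · -- l₁ < 0
      left; right
      refine ⟨signVec D (l₂ / l₁), ⟨l₂ / l₁, rfl⟩, ?_⟩
      funext pq
      simp only [Fm, cmpPat, signVec, dv]
      have hne : l₁ ≠ 0 := h1.ne
      have key : ((pq.2 : Fin 2 → ℝ) 0 - (pq.1 : Fin 2 → ℝ) 0) +
          l₂ / l₁ * ((pq.2 : Fin 2 → ℝ) 1 - (pq.1 : Fin 2 → ℝ) 1) < 0 ↔ l pq.1 < l pq.2 := by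
        rw [← sub_pos (a := l pq.2), hdiff pq]
        constructor
        · intro h
          have := mul_pos_of_neg_of_neg h1 h
          calc (0 : ℝ) < l₁ * ((pq.2 : Fin 2 → ℝ) 0 - (pq.1 : Fin 2 → ℝ) 0 +
              l₂ / l₁ * ((pq.2 : Fin 2 → ℝ) 1 - (pq.1 : Fin 2 → ℝ) 1)) := this
            _ = _ := by field_simp
        · intro h
          have := div_neg_of_pos_of_neg h h1
          calc ((pq.2 : Fin 2 → ℝ) 0 - (pq.1 : Fin 2 → ℝ) 0) +
              l₂ / l₁ * ((pq.2 : Fin 2 → ℝ) 1 - (pq.1 : Fin 2 → ℝ) 1)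
              = (l₁ * ((pq.2 : Fin 2 → ℝ) 0 - (pq.1 : Fin 2 → ℝ) 0) +
                l₂ * ((pq.2 : Fin 2 → ℝ) 1 - (pq.1 : Fin 2 → ℝ) 1)) / l₁ := by
                field_simp
            _ < 0 := this
      by_cases hc : l pq.1 < l pq.2
      · have hneg := key.mpr hc
        simp [hc, sign_neg hneg]
      · have hnneg : ¬ _ < (0 : ℝ) := fun h => hc (key.mp h)
        rcases eq_or_lt_of_le (not_lt.mp hnneg) with h0 | hpos
        · simp [hc, ← h0]
        · simp [hc, sign_pos hpos]
  have hSVfin : (Set.range (signVec D)).Finite := Set.toFinite _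
  have hSV := ncard_range_signVec_le D
  have hDcard : D.card ≤ P.card * P.card := card_diffSet_le P
  have hG : (G '' Set.univ).ncard ≤ 3 := by
    calc (G '' Set.univ).ncard ≤ (Set.univ : Set SignType).ncard :=
          Set.ncard_image_le (Set.toFinite _)
      _ = 3 := by rw [Set.ncard_univ, Nat.card_eq_fintype_card]; rfl
  calc (Set.range (cmpPat P)).ncard
      ≤ ((Fp '' Set.range (signVec D) ∪ Fm '' Set.range (signVec D)) ∪ G '' Set.univ).ncard :=
        Set.ncard_le_ncard hcover (Set.toFinite _)
    _ ≤ (Fp '' Set.range (signVec D) ∪ Fm '' Set.range (signVec D)).ncard + (G '' Set.univ).ncard :=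
        Set.ncard_union_le _ _
    _ ≤ ((Fp '' Set.range (signVec D)).ncard + (Fm '' Set.range (signVec D)).ncard) +
          (G '' Set.univ).ncard := by gcongr; exact Set.ncard_union_le _ _
    _ ≤ ((Set.range (signVec D)).ncard + (Set.range (signVec D)).ncard) + 3 := by
        gcongr
        · exact Set.ncard_image_le hSVfin
        · exact Set.ncard_image_le hSVfin
    _ ≤ 4 * (P.card * P.card) + 7 := by omega

end CmpPat

/-- **stub_cmpPatCount** (registered stub of crux stmt-ValiantsHypothesis-5907, line
`annihilator-product-functional`; sub-goal of `stub_topTupleCount`): `ncard_range_cmpPat_le` with the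
pattern map written out — over all continuous linear functionals `l` on `ℝ²`, the comparison pattern
`(p, q) ↦ [l p < l q]` on a finite `P` takes at most `4 |P|² + 7` values. [folklore] -/
theorem stub_cmpPatCount (P : Finset (Fin 2 → ℝ)) :
    (Set.range (fun l : (Fin 2 → ℝ) →L[ℝ] ℝ => fun pq : ↥P × ↥P => decide (l pq.1 < l pq.2))).ncard
      ≤ 4 * (P.card * P.card) + 7 :=
  ncard_range_cmpPat_le P

end

end Summit.ValiantsHypothesis.Theorems.DissociatedFixedK
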